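import Literature.Computability.Complexity.Classes
import Literature.Computability.Complexity.Nondeterministic
import Literature.Computability.Complexity.PolyHierarchy
import Literature.Computability.Complexity.CNF
import Literature.Computability.Complexity.Promise
import Literature.Computability.Complexity.RandomCNF
import Literature.Computability.MetaComplexity.ProofSystems
import Literature.Computability.Cryptography.OneWayFunctions
import Literature.Computability.Cryptography.Indistinguishability
import Literature.Computability.FineGrained.FineGrainedWave0
import Literature.Computability.QuantumComplexity.Factoring
import Literature.Probability.RandomGraphs.PlantedClique
import Literature.Computability.Complexity.Circuit
import Literature.Algebra.EuclideanLattices.LatticeComplexity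
import Literature.Barriers.PneNP.NaturalProofs
import HarnessLib
import HarnessLib.Audit.TribunalTags

/-!
# Strong-Hypothesis Library — summit `PneNP` (problem `PneNP`, Cook's `P ≠ NP`)

Registry (D-0034, tribunal-as-fitness) of the KNOWN STRONG HYPOTHESES `H` for the single problem
`PneNP : Prop := Literature.PNP.PNeNP` (`∃ L ∈ NP Bool, L ∉ P Bool` over `PNPWave0`, Cook's Clay
statement): open, named conjectures which are known — with a proof landed in the tree or printed —
to imply `P ≠ NP`, together with three standard EQUIVALENT REFORMULATIONS (criteria) of `P ≠ NP`
over the tree's second class system (`Classes.P`, `Nondeterministic.NP`). The kernel tribunal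
(`#h21_tribunal`) reads the tags below; the BRIDGES `H → PneNP` (all but three landed) are in the
summit-side file `Summits/PneNP/StrongHypotheses.lean` (`Summit.PneNP.StrongHypotheses.*`), which
also tags the hypotheses that live under `Summits/` (canonical conjecture leaves and crux-audit
hypotheses), since a Literature file never imports `Summits.*`.

## Registered here (Literature side)

Existing Literature declarations, TAGGED (not restated):

* `Literature.Computability.Cryptography.OWFExist` — one-way functions exist (Goldreich 2001,
  §1.5.3, Def. 2.2.1). Strictly stronger than `P ≠ NP`. Bridge landed (`pneNP_shape_of_OWFExist`).
* `Literature.Computability.Cryptography.WeakOWFExist` — weak one-way functions exist (Goldreich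
  Def. 2.2.2; `↔ OWFExist` by Yao, landed). Bridge landed.
* `Literature.Computability.Cryptography.NonuniformOWFExist` — non-uniformly one-way functions
  exist (Goldreich Def. 2.2.6). Bridge landed.
* `Literature.Computability.Cryptography.IOOWFExist` — infinitely-often one-way functions exist
  (Liu–Pass 2020, §2.1). Bridge landed. (Interim Literature copy; the canonical leaf
  `Summit.PneNP.PneNP.IOOWFExist` is tagged summit-side.)
* `Literature.Computability.Cryptography.PRGExist` — pseudorandom generators exist (Goldreich
  §3.3; `↔ OWFExist` in print, HILL). Bridge landed (`pneNP_shape_of_PRGExist`).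
* `Literature.Barriers.PneNP.HardPRGExist` — the SPRNG conjecture / hypothesis of Razborov–Rudich
  Thm. 4.1: a `2^{k^ε}`-hard PRG family in `P/poly`. Bridge landed (through
  `HardPRGExist.not_NP_subset_PPoly`, i.e. `⇒ NP ⊄ P/poly ⇒ P ≠ NP`).
* `Literature.Computability.FineGrained.ETH` — the Exponential Time Hypothesis (Impagliazzo–Paturi
  2001). Bridge landed (`P_ne_NP_of_eth_holds`).
* `Literature.Computability.FineGrained.SETH` — the Strong ETH (Impagliazzo–Paturi–Zane 2001;
  Calabro–Impagliazzo–Paturi 2009). Bridge landed (`eth_of_seth_holds`).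

Newly stated here (typeable over existing tree notions; each an OPEN CONJECTURE `def … : Prop`,
never asserted, CONVENTIONS §4):

* `NPNeCoNP` — `NP ≠ coNP`. Bridge landed (`co P = P`).
* `TautHasNoPolyBoundedProofSystem` — Cook–Reckhow form `¬ HasPolyBoundedProofSystem TAUT`
  (kernel-equivalent to `NP ≠ coNP` in the tree; the commonest proof-complexity crux costume,
  barrier catalogue §C1/C2). Bridge landed.
* `PHDoesNotCollapse` — `∀ k, PH ≠ Σₖᵖ`. Bridge landed.
* `PHNeSigmaPTwo` — `PH ≠ Σ₂ᵖ` (the Karp–Lipton hypothesis; `⇒ NP ⊄ P/poly`). Bridge landed.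
* `EXPNeNEXP` — `EXP ≠ NEXP` (`⇒ P ≠ NP` by padding, Book 1974; Arora–Barak Thm. 2.22). Bridge landed.
* `KrajicekGeneratorConjecture` — Krajíček's proof-complexity generator conjecture (a p-time
  one-bit-stretching map whose range meets every infinite `NP` set; `⇒ NP ≠ coNP`). Bridge landed.
* `FeigeRefutationHypothesis` — Feige's Hypothesis 1 (random 3-SAT at every constant density has
  no polynomial-time refuter), deterministic form `∀ Δ > 0, FeigeHypothesis Δ`. Bridge landed
  (route `PneNP/Feige` deciding theorem with its two proved supports).
* `PlantedCliqueConjecture` — strong-detection planted-clique hardness at `k = ⌈n^{1/2-ε}⌉` for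
  every `ε > 0` (Jerrum 1992 §5; Barak et al. 2019 §1; Brennan–Bresler–Huleihel 2018 Conj. 2.1).
  Bridge landed (route `PneNP/PlantedClique` deciding theorem with its two proved supports).
* `PlantedCliqueQuasipolyHard`, `PlantedCliquePolyHard` — the NON-UNIFORM (circuit) planted-clique
  hypotheses: every strongly detecting `B₂`-circuit family for the planted `⌈n^{1/2-δ}⌉`-clique
  has size `≥ n^{⌊log₂ n⌋/c}` (quasi-polynomial form; Rossman-type conjecture) / no such family of
  polynomial size exists. Canonical registry copies — verbatim the same statements — of
  `QuasipolyHard` / `PolyHard`, which are written inline as the hypothesis of the landed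
  `Summits/PneNP/PneNP/Theorems/KarlinRubinMonotoneSufficesSandwich.lean` (`karlinRubin_monotoneSuffices_of_quasipolyHard`)
  resp. of `KarlinRubinMonotoneBlindDelta.lean` (`karlinRubin_monotoneBlind_of_noPolyB2Detector`) and
  named only in the UNBUILT crux-audit work file `Cruxes/MonotoneSuffices/DecompositionAudit.lean`
  (which no library file can import). Bridges: `PlantedCliqueQuasipolyHard` LANDED (route
  KarlinRubin's `closes`), `PlantedCliquePolyHard` PRINTED.
* `GapSVPPolyApproxNotInP` — no polynomial approximation factor `γ ≥ 1` puts `GapSVP_γ` in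
  promise-`P` (the worst-case lattice hypothesis; Regev 2009 §1, Peikert 2016). Bridge landed.
* `FactoringNotInP` — `¬ FactInP` (integer factoring, decision form, is not in `P`). Bridge
  PRINTED (`FACT ∈ NP`, Arora–Barak Example 2.3; not yet a tree fact).

Criteria (equivalent reformulations `E ↔ PneNP`, all three bridges landed as `Iff`s):

* `NPNotSubsetP` — `¬ (Nondeterministic.NP ⊆ Classes.P)`; `PNeNPClasses` — `Classes.P ≠ Nondeterministic.NP`
  (both `↔ PneNP` by the proved model bridges `p_bool_eq`, `CookBridges.np_bool_eq`, `P ⊆ NP`);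
  `SATNotInP` — `SAT ∉ Classes.P` (`↔ PneNP` by the tree's Cook–Levin theorem `isNPComplete_SAT_holds`).

## Registered summit-side only (declared under `Summits/`, tagged in `Summits/PneNP/StrongHypotheses.lean`)

`Summit.PneNP.PneNP.NPNotSubsetPPoly` (`NP ⊄ P/poly`, canonical conjecture leaf; the interim
Literature duplicate `Literature.Computability.Complexity.NPNotSubsetPPoly` is flagged for deletion
and deliberately NOT tagged), `Summit.PneNP.PneNP.NPNotSubsetBPP` (`NP ⊄ BPP`),
`Summit.PneNP.PneNP.OWFExist`, `Summit.PneNP.PneNP.IOOWFExist` (canonical leaves),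
`Summit.PneNP.PneNP.LWENotInBQP` (bridge: none — see there). The audit variant `QuasipolyHard'`
(additive-`n` slack) of `DecompositionAudit.lean` is not copied (a technical variant of
`PlantedCliqueQuasipolyHard`, implying `PlantedCliquePolyHard`).

## Not registered, and why

* `VP ≠ VNP` (`Summit.PneNP.PneNP.VPNeVNPComplex`), the Unique Games Conjecture, `NEXP ⊄ P/poly`,
  `P ≠ PSPACE`, `EF` / Frege lower bounds (`Literature.Computability.Complexity.EFNotPolyBounded`),
  the OV / 3SUM / APSP conjectures: NOT known to imply `P ≠ NP` (weaker than, incomparable with,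
  or implied by it), hence not strong hypotheses in the sense of D-0033 T1(a).
* `MCSP ∉ P`, `NP ⊄ coNP/poly`, `Σ₂ᵖ ≠ Π₂ᵖ`, `NP ⊄ P/poly`-for-`SAT` (`SAT ∉ P/poly`): typeable, but
  either kernel-equivalent to a registered entry (`SAT ∉ P/poly ↔ NPNotSubsetPPoly`,
  `npNotSubsetPPoly_iff`) or one `Iff`/lemma away from one (`Σ₂ᵖ ≠ Π₂ᵖ ⇒ NPNeCoNP`); left for a
  second pass to keep the registry small.
* Not yet typeable: none of the intended entries needed vocabulary the tree lacks.

## Sources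

[CookClay2006] §1, §3 · [AroraBarakCC2009] §2.1, Thm. 2.10, Thm. 2.22, §2.6, Thm. 5.4, §6.4, Ch. 9
· [Goldreich2001] §1.5.3, §2.2, §3.3 · [RazborovRudich1997] Thm. 4.1 · [Buss1997BoundedArithmeticPPC]
Part III · [ImpagliazzoPaturiJCSS2001] §1 · [ImpagliazzoPaturiZaneJCSS2001] · [CookReckhow1979] §1 ·
[Stockmeyer1976] §3 · [KarpLipton1980] · [Book1974] · [Krajicek2022] §1 · [Feige2002] §1 ·
[Jerrum1992] §5 · [BarakHopkinsKelnerKothariMoitraPotechin2019] §1 · [BrennanBreslerHuleihel2018]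
Conj. 2.1 · [Regev2009] §1 · [Peikert2016] · [MicciancioGoldwasser2002] Ch. 1 · [AharonovRegev2005] §1.
-/

namespace Literature.StrongHypotheses.PneNP

open Literature.Computability.Complexity Literature.Computability.MetaComplexity
open Literature.Probability.RandomGraphs.PlantedClique Literature.Algebra.EuclideanLattices

/-! ### Existing Literature conjectures: tags only (no restatement) -/

attribute [strong_hypothesis "PneNP.PneNP"] Literature.Computability.Cryptography.OWFExist
attribute [strong_hypothesis "PneNP.PneNP"] Literature.Computability.Cryptography.WeakOWFExist
attribute [strong_hypothesis "PneNP.PneNP"] Literature.Computability.Cryptography.NonuniformOWFExist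
attribute [strong_hypothesis "PneNP.PneNP"] Literature.Computability.Cryptography.IOOWFExist
attribute [strong_hypothesis "PneNP.PneNP"] Literature.Computability.Cryptography.PRGExist
attribute [strong_hypothesis "PneNP.PneNP"] Literature.Barriers.PneNP.HardPRGExist
attribute [strong_hypothesis "PneNP.PneNP"] Literature.Computability.FineGrained.ETH
attribute [strong_hypothesis "PneNP.PneNP"] Literature.Computability.FineGrained.SETH

/-! ### Class separations above `P ≠ NP` -/

/-- OPEN CONJECTURE — **`NP ≠ coNP`**: the class `NP` (`Nondeterministic.NP = ∃ᵖ·P`) is not closed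
under complement, `NP ≠ coNP = co NP`. Posed by Cook–Reckhow (1979, §1: "NP closed under
complementation" is open, and by their Prop. 1.1 it fails iff no propositional proof system is
polynomially bounded); Arora–Barak 2009, §2.6.1 record it as the standing belief. Strictly stronger
than `P ≠ NP` (`P = NP ⇒ NP = P = co P = coNP`; `co P = P` is the tree fact `co_P_holds`).
[cite: CookReckhow1979, §1 (the NP vs coNP question; Prop. 1.1)] [cite: AroraBarakCC2009, §2.6.1] [status: open] -/
@[strong_hypothesis "PneNP.PneNP"] def NPNeCoNP : Prop :=
  Nondeterministic.NP ≠ coNP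

/-- OPEN CONJECTURE — **no polynomially bounded proof system for `TAUT`** (Cook–Reckhow form of
`NP ≠ coNP`): there is no abstract proof system for the propositional tautologies `TAUT` in which
every tautology has a proof of size polynomial in its length (`¬ HasPolyBoundedProofSystem TAUT`,
tree notion of `MetaComplexity/ProofSystems.lean`). Cook–Reckhow 1979, §1, Prop. 1.1: equivalent to
`NP ≠ coNP` (tree: `NP_eq_coNP_iff_hasPolyBoundedProofSystem_TAUT_holds`); it is the shared rank-0
target of the proof-complexity routes of this summit (barrier catalogue §C1–C2). Strictly stronger
than `P ≠ NP`. [cite: CookReckhow1979, §1 Prop. 1.1 ("Cook's program")] [status: open] -/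
@[strong_hypothesis "PneNP.PneNP"] def TautHasNoPolyBoundedProofSystem : Prop :=
  ¬ HasPolyBoundedProofSystem TAUT

/-- OPEN CONJECTURE — **the polynomial hierarchy does not collapse**: for every level `k`,
`PH ≠ Σₖᵖ` (`PH = ⋃ₖ Σₖᵖ`, `SigmaP`, Stockmeyer 1976 §3 / Arora–Barak Def. 5.3). Arora–Barak
2009, §5.2 (after Thm. 5.4) record the conjecture that the hierarchy is infinite as the standard
belief generalising `P ≠ NP` and `NP ≠ coNP`; at `k = 0` it reads `PH ≠ P`, at `k = 1` `PH ≠ NP`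
(`⇒ NP ≠ coNP`, Thm. 5.4). Strictly stronger than `P ≠ NP`.
[cite: AroraBarakCC2009, §5.2 (Thm. 5.4 and the non-collapse conjecture)] [cite: Stockmeyer1976, §3] [status: open] -/
@[strong_hypothesis "PneNP.PneNP"] def PHDoesNotCollapse : Prop :=
  ∀ k : ℕ, PH ≠ SigmaP k

/-- OPEN CONJECTURE — **`PH ≠ Σ₂ᵖ`** (the polynomial hierarchy does not collapse to its second
level): the hypothesis of the Karp–Lipton theorem in contrapositive (`NP ⊆ P/poly ⇒ PH = Σ₂ᵖ`,
Karp–Lipton 1980; Arora–Barak 2009, Thm. 6.19), under which `NP ⊄ P/poly`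
(tree: `NPNotSubsetPPoly_of_PH_ne_SigmaP_two`) and hence `P ≠ NP`. The most quoted single instance
of `PHDoesNotCollapse`. [cite: AroraBarakCC2009, Thm. 6.19 (Karp–Lipton) with §5.2] [cite: KarpLipton1980, Thm. 6.1 (hypothesis, contrapositive form)] [status: open] -/
@[strong_hypothesis "PneNP.PneNP"] def PHNeSigmaPTwo : Prop :=
  PH ≠ SigmaP 2

/-- OPEN CONJECTURE — **`EXP ≠ NEXP`**: deterministic and nondeterministic exponential time differ
(`EXP = ⋃ DTIME(2^{n^k})`, `NEXP`, tree classes). By padding (Book 1974; Arora–Barak 2009,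
Thm. 2.22 "If `EXP ≠ NEXP` then `P ≠ NP`", tree: `P_ne_NP_of_EXP_ne_NEXP`) it is at least as strong
as `P ≠ NP`, and it is open. [cite: AroraBarakCC2009, Thm. 2.22 and §2.6.2] [cite: Book1974, §3 (tally languages and the padding argument)] [status: open] -/
@[strong_hypothesis "PneNP.PneNP"] def EXPNeNEXP : Prop :=
  EXP ≠ NEXP

/-- OPEN CONJECTURE — **Krajíček's generator conjecture** (Krajíček 2004; restated as the displayed
conjecture of Krajíček, *On the existence of strong proof complexity generators*, §1): there is a
polynomial-time function `g : {0,1}* → {0,1}*` (`g ∈ FP`) stretching every input by exactly one bit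
whose range meets EVERY infinite `NP` language. It implies `NP ≠ coNP` (the complement of the range
would be an infinite `coNP` set with no infinite `NP` subset; tree:
`Summit.PneNP.PneNP.Theorems.NP_ne_coNP_of_stretching_generator`), hence `P ≠ NP`. Verbatim the
body of the route crux `ProofCplx.ProofcplxKrajicekGenerator`. [cite: Krajicek2022, §1 (the conjecture, p. 4)] [status: open] -/
@[strong_hypothesis "PneNP.PneNP"] def KrajicekGeneratorConjecture : Prop :=
  ∃ g : List Bool → List Bool, g ∈ FP ∧ (∀ x, (g x).length = x.length + 1) ∧
    ∀ L ∈ Nondeterministic.NP, L.Infinite → ∃ x, g x ∈ L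

/-! ### Average-case hardness hypotheses -/

/-- OPEN CONJECTURE — **Feige's random-3SAT refutation hypothesis** (Feige, STOC 2002, §1,
Hypothesis 1: "Even if `Δ` is an arbitrarily large constant, there is no polynomial time algorithm
that refutes most Random-3SAT formulas with `n` variables and `m = Δn` clauses"), in the tree's
deterministic, satisfiable-sound form: for every density `Δ > 0`, `FeigeHypothesis Δ`
(`Literature.Computability.Complexity.FeigeHypothesis`: no polynomial-time predicate accepts only
unsatisfiable 3-CNFs and accepts `F₃(n, ⌈Δn⌉)` with probability `≥ 1/2` for all large `n`). For
`Δ` below the satisfiability threshold it is provable (`feigeHypothesis_zero`); the content is at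
large constant `Δ`. Implies `P ≠ NP` (under `P = NP` the complement of a SAT decider is a sound
refuter succeeding above density `log 2 / log(8/7)` by the first-moment bound; route `PneNP/Feige`).
[cite: Feige2002, §1 Hypothesis 1] [status: open] -/
@[strong_hypothesis "PneNP.PneNP"] def FeigeRefutationHypothesis : Prop :=
  ∀ Δ : ℝ, 0 < Δ → FeigeHypothesis Δ

/-- OPEN CONJECTURE — **the Planted Clique conjecture, strong-detection form**: for every `ε > 0`
no probabilistic polynomial-time test distinguishes `G(n, 1/2)` from `G(n, 1/2)` with a planted
clique on `⌈n^{1/2-ε}⌉` vertices with vanishing type-I + type-II error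
(`PlantedCliqueDetectionHard`, `Literature/Probability/RandomGraphs/PlantedClique.lean`). Posed by
Jerrum (1992, §5) and Kučera (1995); the working conjecture of Barak–Hopkins–Kelner–Kothari–
Moitra–Potechin (2019, §1, Remark 2: decision variant) and, in this liminf form at `p = 1/2`,
Brennan–Bresler–Huleihel 2018, Conjecture 2.1. Implies `P ≠ NP` (under `P = NP` an exact
`CLIQUE(⌈n^{1/2-ε}⌉)` decider is a polynomial-time test with type-II error `0` and type-I error
`→ 0` by the first-moment clique bound for `G(n,1/2)`; route `PneNP/PlantedClique`). Verbatim the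
body of the route crux `PlantedClique.PlantedcliqueDetectionHard`.
[cite: BrennanBreslerHuleihel2018, Conjecture 2.1] [cite: BarakHopkinsKelnerKothariMoitraPotechin2019, §1 Remark 2] [cite: Jerrum1992, §5] [status: open] -/
@[strong_hypothesis "PneNP.PneNP"] def PlantedCliqueConjecture : Prop :=
  ∀ ε : ℝ, 0 < ε → PlantedCliqueDetectionHard (fun n : ℕ => ⌈(n : ℝ) ^ (1 / 2 - ε)⌉₊)

/-- OPEN CONJECTURE — **planted cliques below `√n` need quasi-polynomial circuits**
(`QuasipolyHard`, QPH): for every `δ ∈ (0, 1/2)` there is `c` such that every family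
`C = (Cₙ)` of `B₂`-circuits on the edge indicators of `Kₙ` which STRONGLY DETECTS the planted
`⌈n^{1/2-δ}⌉`-clique (`G(n,1/2)`-acceptance plus planted-rejection probability `→ 0`;
`erdosRenyiHalf`, `plantedCliqueDist`) has `n^{⌊log₂ n⌋} ≤ |Cₙ|^c` for all large `n` — the
non-uniform, quantitative form of the planted-clique conjecture (Jerrum 1992 §5 poses the hardness
of finding planted cliques of size `n^{1/2-ε}`; the quasi-polynomial `n^{Θ(log n)}` truth is the
Rossman-type prediction recorded by Barak et al. 2019, §1). Canonical registry copy, VERBATIM the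
hypothesis written inline in `Summits/PneNP/PneNP/Theorems/KarlinRubinMonotoneSufficesSandwich.lean`
(`karlinRubin_monotoneSuffices_of_quasipolyHard`, l. 70) and named `QuasipolyHard` in the unbuilt
audit file `Summits/PneNP/PneNP/Cruxes/MonotoneSuffices/DecompositionAudit.lean`. Implies `P ≠ NP`
(route KarlinRubin: it yields both cruxes `MonotoneSuffices`, `MonotoneBlind`, whose deciding
theorem with the two proved supports gives `PneNP`).
[cite: Jerrum1992, §5 (planted cliques of size n^{1/2-ε})] [cite: BarakHopkinsKelnerKothariMoitraPotechin2019, §1] [status: open] -/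
@[strong_hypothesis "PneNP.PneNP"] def PlantedCliqueQuasipolyHard : Prop :=
  ∀ δ : ℝ, 0 < δ → δ < 1 / 2 → ∃ c : ℕ,
    ∀ C : (n : ℕ) → Circuit ((⊤ : SimpleGraph (Fin n)).edgeSet),
      (∀ᶠ n : ℕ in Filter.atTop, (C n).IsOver B2) →
      Filter.Tendsto (fun n : ℕ =>
        (erdosRenyiHalf n).toOuterMeasure {x | (C n).eval x = true} +
          (plantedCliqueDist n ⌈(n : ℝ) ^ (1 / 2 - δ)⌉₊).toOuterMeasure {x | (C n).eval x = false})
        Filter.atTop (nhds 0) →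
      ∀ᶠ n : ℕ in Filter.atTop, n ^ (Nat.log 2 n) ≤ (C n).size ^ c

/-- OPEN CONJECTURE — **no polynomial-size circuits detect planted cliques below `√n`**
(`PolyHard`): for every `δ ∈ (0, 1/2)` and every `c` there is NO family of `B₂`-circuits of size
`≤ n^c` (eventually) that strongly detects the planted `⌈n^{1/2-δ}⌉`-clique. The non-uniform
polynomial form of the planted-clique conjecture (Jerrum 1992 §5; Barak et al. 2019 §1 Remark 2),
implied by `PlantedCliqueQuasipolyHard`. Canonical registry copy, VERBATIM the hypothesis of the
landed `karlinRubin_monotoneBlind_of_noPolyB2Detector`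
(`Summits/PneNP/PneNP/Theorems/KarlinRubinMonotoneBlindDelta.lean`) and named `PolyHard` in the
unbuilt audit file `Cruxes/MonotoneSuffices/DecompositionAudit.lean`. Implies `P ≠ NP` (under
`P = NP`, `CLIQUE ∈ P ⊆ P/poly` gives polynomial exact clique circuits, which strongly detect);
bridge PRINTED (`Summit.PneNP.StrongHypotheses.PlantedCliquePolyHardImpliesPneNP`).
[cite: Jerrum1992, §5 (planted cliques of size n^{1/2-ε})] [cite: BarakHopkinsKelnerKothariMoitraPotechin2019, §1 Remark 2] [status: open] -/
@[strong_hypothesis "PneNP.PneNP"] def PlantedCliquePolyHard : Prop :=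
  ∀ δ : ℝ, 0 < δ → δ < 1 / 2 → ∀ c : ℕ, ¬ ∃ C : (n : ℕ) → Circuit ((⊤ : SimpleGraph (Fin n)).edgeSet),
    (∀ᶠ n : ℕ in Filter.atTop, (C n).IsOver B2 ∧ (C n).size ≤ n ^ c) ∧
      Filter.Tendsto (fun n : ℕ =>
        (erdosRenyiHalf n).toOuterMeasure {x | (C n).eval x = true} +
          (plantedCliqueDist n ⌈(n : ℝ) ^ (1 / 2 - δ)⌉₊).toOuterMeasure {x | (C n).eval x = false})
        Filter.atTop (nhds 0)

/-- OPEN CONJECTURE — **`GapSVP` is hard to approximate within every polynomial factor**: for no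
polynomially bounded factor `γ = γ(n) ≥ 1` (`IsPolyBoundedReal γ`, `∀ n, 1 ≤ γ n`) is the promise
problem `GapSVP_γ` (`gapSVPPromise γ`: yes iff `λ₁(L(B)) ≤ d`, no iff `λ₁(L(B)) > γ(n)·d`) in
promise-`P`. This is the worst-case hypothesis underlying lattice-based cryptography (Regev 2009,
§1: no polynomial-time algorithm is known, or believed to exist, for polynomial approximation
factors; Peikert 2016; Micciancio–Goldwasser 2002, Ch. 1); the classical analogue of the tree's
`GapSVPQuantumHardness`. Since `GapSVP_γ ∈ promise-NP` for every `γ ≥ 1` (tree: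
`gapSVP_mem_promiseNP_holds`, Aharonov–Regev 2005 §1) it implies `P ≠ NP`. Verbatim the body of
the route thesis `Lattice.LatticeThesis`. [cite: Regev2009, §1 (hardness of polynomial-factor GapSVP as the standing assumption)] [cite: Peikert2016, §2 (worst-case lattice assumptions)] [cite: MicciancioGoldwasser2002, Ch. 1 §1.2] [status: open] -/
@[strong_hypothesis "PneNP.PneNP"] def GapSVPPolyApproxNotInP : Prop :=
  ∀ γ : ℕ → ℝ, IsPolyBoundedReal γ → (∀ n, 1 ≤ γ n) → gapSVPPromise γ ∉ PromiseP

/-- OPEN CONJECTURE — **integer factoring is not in `P`** (decision form): `¬ FactInP`, i.e. the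
language `FACT = {⟨N, k⟩ : N has a prime factor ≤ k}` (`Literature.Computability.QuantumComplexity.FACT`,
Arora–Barak Example 2.3) is decided by no deterministic polynomial-time machine. The tree registers
the NEGATION `FactInP` as the open statement (acceptance target pqc.S04, "conjectured false");
this is the conjectured direction, the standing assumption behind RSA (Arora–Barak 2009, §9.2.1).
Since `FACT ∈ NP` (guess the factor) it implies `P ≠ NP`; that membership is not yet a tree fact,
so the bridge is PRINTED (`Summit.PneNP.StrongHypotheses.FactoringNotInPImpliesPneNP`).
[cite: AroraBarakCC2009, Example 2.3 (p. 40) and §9.2.1 (factoring as a hardness assumption)] [status: open] -/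
@[strong_hypothesis "PneNP.PneNP"] def FactoringNotInP : Prop :=
  ¬ Literature.Computability.QuantumComplexity.FactInP

/-! ### Criteria: equivalent reformulations of `PneNP` over the tree's classes -/

/-- CRITERION (equivalent to `PneNP`) — **`NP ⊄ P` over the tree's classes**:
`¬ (Nondeterministic.NP ⊆ Classes.P)` (Arora–Barak Def. 1.13 / 2.1 classes over Mathlib `TM2`).
Kernel-equivalent to Cook's Clay statement `PneNP` through the proved model bridges
`p_bool_eq`, `CookBridges.np_bool_eq` (bridge `npNotSubsetP_iff_pneNP`, summit side). Registered
because it is the form in which most route assemblies consume `¬ PneNP`.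
[cite: CookClay2006, §1 ("Does P = NP?"; P ⊆ NP is trivial)] -/
@[strong_hypothesis "PneNP.PneNP"] def NPNotSubsetP : Prop :=
  ¬ (Nondeterministic.NP ⊆ Classes.P)

/-- CRITERION (equivalent to `PneNP`) — **`P ≠ NP` over the tree's classes**:
`Classes.P ≠ Nondeterministic.NP`. Kernel-equivalent to `PneNP`
(`pneNP_shape_iff_P_ne_NP`, `CookBridges.lean`; bridge `pNeNPClasses_iff_pneNP`, summit side).
[cite: CookClay2006, §1 ("Does P = NP?")] -/
@[strong_hypothesis "PneNP.PneNP"] def PNeNPClasses : Prop :=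
  Classes.P ≠ Nondeterministic.NP

/-- CRITERION (equivalent to `PneNP`) — **`SAT ∉ P`**: the language of satisfiable CNF codes
(`SAT`, `Complexity/CNF.lean`) has no deterministic polynomial-time decider. Equivalent to `P ≠ NP`
by the Cook–Levin theorem (Arora–Barak 2009, Thm. 2.10 with Thm. 2.8(3): an NP-complete language
is in `P` iff `P = NP`; tree: `isNPComplete_SAT_holds`, `NP_subset_P_of_isNPComplete_of_mem_P`;
bridge `satNotInP_iff_pneNP`, summit side). [cite: AroraBarakCC2009, Thm. 2.10 with Thm. 2.8(3)] [cite: CookClay2006, §2–3 (SAT is NP-complete; lower bounds for SAT settle the problem)] -/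
@[strong_hypothesis "PneNP.PneNP"] def SATNotInP : Prop :=
  SAT ∉ Classes.P

end Literature.StrongHypotheses.PneNP
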